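import Summits.QuantumFields.BalabanUV.Beta.SpineRecursiveT2AllClosed
import Summits.QuantumFields.BalabanUV.Beta.SecondOrderLockPin
import Summits.QuantumFields.BalabanUV.Beta.SecondOrderZeroCanon

/-!
# `BalabanUV.Beta.SpineRecursiveT2AllCanon` — binder row D1, (L4): **hR FOR THE RECURSIVE WALL LITERAL ⟸ THE LETTERS, WITH THE CANONICAL
# SECOND SYMBOL AND THE LEVEL-`0` LETTER SPLIT INTO ITS WILSON AND BORDER PARTS** — `SpineRecursiveT2AllClosed.…_of_letters_closed` with
# (i) the second-symbol family FIXED to the canonical `h j α κ u κ′ u′ p c := γ_j² · ctGen κ u p c · ctGen κ′ u′ p c` (`X₂ := X∘X′`; its classes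
# `hhb`/`hhl` are lemmas, `SecondOrderZeroCanon.canon_classes`), (ii) the level-`0` letter `h0` ASSEMBLED (`SecondOrderZeroCanon.quarticZero_bref_of_ffLaw`)
# from the PARAMETER-FREE Wilson (2,2) law (hWff) [an3's row, `ff`-entrywise, coefficients `(−½, ¼)`, odd field-supported slot `RW`] and the
# border letter AT LEVEL `0`, (iii) the border letter stated UNIFORMLY for every level `j ≥ 0` [an1's row], (iv) the level-`0` remainder class
# derived (`R2 0 = cE₂ • RW + RB 0`) — so the free remainder `R2` carries hypotheses at levels `j + 1` only (the class induction, row HR-W-CLASS-Q,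
# removes those next) (β sub-cell, row BETA-an2 = BINDER-OWNERS row D1 OWNER, lineage an2 gen 19)

HONEST FRAMING (cell charter, verbatim): «discharging BetaPertH makes Balaban's UV stability UNCONDITIONAL — a real
constructive-QFT result; it is NOT the continuum limit and NOT the Clay problem.»  DERIVED cell leaf (wiring, [folklore]); no statement of
Bałaban's papers, no `[cite:]`, no `def`, no `Prop` fact.  EVERY LETTER IS STILL A HYPOTHESIS; the file instantiates no binder of the wall by
itself.  NOT D1, NOT `BetaPertH`, NOT continuum, NOT Clay.

**`axisReflectionCovariant_flipK_TbalOf_JsRecWAtOf_of_letters_canon`**: `∀ j, AxisReflectionCovariant (flipK (TbalOf Lc (JsRecWAtOf …) j))`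
(`d + 1 = 4`, odd `Lc`, centred root, pin `(cE, cVH) = (Lc⁴, −Lc⁸/2)`) from EXACTLY:
* THE LETTERS — (hWff) the Wilson (2,2) reflection law at level `0`, `ff`-entrywise against `bhKStepAt 0 = bhKAt`, letters `wilsonA`, generator
  coefficient `κ_W = −½` (an3's `wilsonA_bref`), canonical second symbol, odd field-supported residual `RW α` [an3]; (hBfm/hBmf/hBmm) the border
  letter at EVERY level `j ≥ 0` with the canonical symbol and an odd, `ff`-vanishing, `LocStencil₂` residual `RB j α` [an1]; (hM2) the mixed letter
  ∀ j with an odd `LocStencilFM` residual `RM j α` [an1];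
* THE DATA DEFINITIONS (hX2s)/(hΔ) (displayed symbols of the split, canonical `h`), the remainder recursion (hR20)/(hR2succ) and the classes of
  `R2 (j+1) α` (row HR-W-CLASS-Q — the only non-letter residue), (hlock2) (⟺ `cE₂ = Lc⁸`), (hBt)/(hmixt) and the classes of `vh₂S`/`mixFF`.
Provenance: β sub-cell, unit beta-an2 gen 19, 2026-08-20 (v1); no existing file touched.
-/

open Finset
open scoped BigOperators
open Literature.MathematicalPhysics.QuantumFieldTheory
open Literature.MathematicalPhysics.QuantumFieldTheory.Balaban1983to89
open Literature.MathematicalPhysics.QuantumFieldTheory.Balaban1983to89.Beta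
open ExpKernelCalculus (MKer Decays BiLoc comp tadpole VertexFamily VertexFamily₂ shiftK)
open AffineAveraging (box toSite)
open AveragingContoursRooted (ctr ctrOff ctrOff_mem_box)
open AveragingHessianKernelsRooted (vhSAt)
open PolarizationSign (reflSign AxisReflectionCovariant)
open KernelReflection (refK refK_apply)
open ResolventReflection (bref Φ)
open OneStepResolventKernel (Fib LocStencil JetData wsum)
open OneStepKernelFamily (KInvStep colH vertexOfK TbalOf flipK)
open StepJetData (wilsonA)
open WilsonBiStencil (wilsonW₂)
open BalabanStepJetsSucc (wE wVH mmRead)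
open BalabanCompositeJets (LocStencil₂)
open BalabanStepW2 (M2Of wV4 wB2 locStencil₂_smul' locStencil₂_add')
open SecondOrderResponse (dM W2OfK W2SymOfK LocStencilFM vertex2OfK mixOfK K2OfK)
open Summit.QuantumFields.BalabanUV.Beta.TameKernelCalculus
open Summit.QuantumFields.BalabanUV.Beta.ChartConjugation (conjV conjW)
open Summit.QuantumFields.BalabanUV.Beta.AxialDressingRooted (coDressKBmAt)
open Summit.QuantumFields.BalabanUV.Beta.BorderedHessian (diagK ctGen bhKStepAt bhKStepAt_zero stepScale sgnK)
open Summit.QuantumFields.BalabanUV.Beta.WardLocusCubic (mmSym)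
open Summit.QuantumFields.BalabanUV.Beta.KernelWardLevels (stepScale_zero)
open Summit.QuantumFields.BalabanUV.Beta.KernelWardRemainderParity (parityOdd_add)
open Summit.QuantumFields.BalabanUV.Beta.SpineRecursiveParity (parityOdd_smul)
open Summit.QuantumFields.BalabanUV.Beta.SecondOrderZeroCanon (quarticZero_bref_of_ffLaw abs_ctGen_mul_ctGen_le locStencil₂_diagK_ctGen_mul_ctGen)

noncomputable section

namespace Summit.QuantumFields.BalabanUV.Beta.SpineRooted

section Wall

variable {Lc : ℕ} [NeZero Lc]

/-- [folklore] **hR ⟸ THE LETTERS, CANONICAL SECOND SYMBOL, LEVEL-`0` LETTER SPLIT** (see the module docstring). -/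
theorem axisReflectionCovariant_flipK_TbalOf_JsRecWAtOf_of_letters_canon (hLc : Odd Lc) (cΛ cE₂ cB : ℝ) (T : Fin 4 → Fin 4 → Fin 4 → Fin 4 → ℝ)
    {vh₂S : Fin 4 → (Fin 4 → ℤ) → Fin 4 → (Fin 4 → ℤ) → MKer 4 (Fib 3)} (hB : ∃ C δ : ℝ, 0 < δ ∧ LocStencil₂ vh₂S C δ)
    (hB0 : ∀ κ u κ' u' (x z : Fin 4 → ℤ) (β β' : Fin 4), vh₂S κ u κ' u' x z (Sum.inl β) (Sum.inl β') = 0)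
    {mixFF : Fin 4 → (Fin 4 → ℤ) → Fin 4 → (Fin 4 → ℤ) → MKer 4 (Fib 3)} (hmix : ∃ C δ : ℝ, 0 < δ ∧ LocStencilFM Lc mixFF C δ)
    (γ : ℕ → ℝ) (hγ : ∀ j, γ j = -((Lc : ℝ) ^ 8 / 2) * wVH 3 Lc j / (stepScale 3 Lc j * (Lc : ℝ) ^ 4))
    (hlock2 : ∀ j, cE₂ * wV4 3 Lc (j + 1) * wVH 3 Lc (j + 1) = ((Lc : ℝ) ^ 4 * wE 3 Lc (j + 1)) ^ 2)
    (R2 : ℕ → Fin 4 → Fin 4 → (Fin 4 → ℤ) → Fin 4 → (Fin 4 → ℤ) → MKer 4 (Fib 3))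
    (RM : ℕ → Fin 4 → Fin 4 → (Fin 4 → ℤ) → Fin 4 → (Fin 4 → ℤ) → MKer 4 (Fib 3))
    (RW : Fin 4 → Fin 4 → (Fin 4 → ℤ) → Fin 4 → (Fin 4 → ℤ) → MKer 4 (Fib 3))
    (RB : ℕ → Fin 4 → Fin 4 → (Fin 4 → ℤ) → Fin 4 → (Fin 4 → ℤ) → MKer 4 (Fib 3))
    -- (hWff) THE WILSON (2,2) LETTER AT LEVEL 0, PARAMETER-FREE UP TO AN ODD FIELD-SUPPORTED SLOT `RW`
    (hWff : ∀ (α κ : Fin 4) (u : Fin 4 → ℤ) (κ' : Fin 4) (u' : Fin 4 → ℤ) (x z : Fin 4 → ℤ) (β β' : Fin 4),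
      wilsonW₂ 3 T κ (bref α κ u) κ' (bref α κ' u') x z (Sum.inl β) (Sum.inl β') =
        ((reflSign α κ * reflSign α κ') • refK (Φ Lc α)
          (wilsonW₂ 3 T κ u κ' u' +
            conjW (bhKStepAt 3 (toSite (ctrOff 4 Lc)) Lc 0) (wilsonA 3 κ u) (wilsonA 3 κ' u')
              (diagK fun p c => (-(1 / 2 : ℝ)) * ctGen 3 α Lc κ u p c) (diagK fun p c => (-(1 / 2 : ℝ)) * ctGen 3 α Lc κ' u' p c)
              (diagK fun p c => (-(1 / 2 : ℝ)) ^ 2 * (ctGen 3 α Lc κ u p c * ctGen 3 α Lc κ' u' p c)) + RW α κ u κ' u')) x z (Sum.inl β) (Sum.inl β'))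
    (hRWl : ∀ α κ u κ' u' (x z : Fin 4 → ℤ) (m : Fin 4) (b' : Fib 3), RW α κ u κ' u' x z (Sum.inr m) b' = 0)
    (hRWr : ∀ α κ u κ' u' (x z : Fin 4 → ℤ) (a' : Fib 3) (m : Fin 4), RW α κ u κ' u' x z a' (Sum.inr m) = 0)
    (hRWc : ∀ α : Fin 4, ∃ C δ : ℝ, 0 < δ ∧ LocStencil₂ (RW α) C δ)
    (hRWp : ∀ (α : Fin 4) κ u κ' u', trK (RW α κ u κ' u') = -sgnK (RW α κ u κ' u'))
    -- (hM2) THE MIXED LETTER ∀ j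
    (hM2 : ∀ (j : ℕ) (α κ : Fin 4) (u : Fin 4 → ℤ) (ρ : Fin 4) (w : Fin 4 → ℤ),
      M2Of 3 Lc mixFF j κ (bref α κ u) ρ (bref α ρ w) =
        (reflSign α κ * reflSign α ρ) • refK (Φ Lc α)
          (M2Of 3 Lc mixFF j κ u ρ w + conjV (M1At 3 Lc (toSite (ctrOff 4 Lc)) cΛ j ρ w) (diagK fun p c => γ j * ctGen 3 α Lc κ u p c) +
            RM j α κ u ρ w))
    (hRMc : ∀ (j : ℕ) (α : Fin 4), ∃ C δ : ℝ, 0 < δ ∧ LocStencilFM Lc (RM j α) C δ)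
    (hRMp : ∀ (j : ℕ) (α : Fin 4) κ u ρ w, trK (RM j α κ u ρ w) = -sgnK (RM j α κ u ρ w))
    -- (hB*) THE BORDER LETTER AT EVERY LEVEL j ≥ 0, CANONICAL SECOND SYMBOL
    (hRBff : ∀ j α κ u κ' u' (x z : Fin 4 → ℤ) (β β' : Fin 4), RB j α κ u κ' u' x z (Sum.inl β) (Sum.inl β') = 0)
    (hRBc : ∀ (j : ℕ) (α : Fin 4), ∃ C δ : ℝ, 0 < δ ∧ LocStencil₂ (RB j α) C δ)
    (hRBp : ∀ (j : ℕ) (α : Fin 4) κ u κ' u', trK (RB j α κ u κ' u') = -sgnK (RB j α κ u κ' u'))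
    (hBfm : ∀ (j : ℕ) (α : Fin 4) κ u κ' u' (x z : Fin 4 → ℤ) (β m : Fin 4),
      ((cB * wB2 3 Lc j) • vh₂S κ (bref α κ u) κ' (bref α κ' u')) x z (Sum.inl β) (Sum.inr m) =
        ((reflSign α κ * reflSign α κ') • refK (Φ Lc α) ((cB * wB2 3 Lc j) • vh₂S κ u κ' u' +
          conjW (bhKStepAt 3 (toSite (ctrOff 4 Lc)) Lc j)
            (SpureRecAt 3 Lc (toSite (ctrOff 4 Lc)) ((Lc : ℝ) ^ 4) (-((Lc : ℝ) ^ 8 / 2)) cΛ j κ u)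
            (SpureRecAt 3 Lc (toSite (ctrOff 4 Lc)) ((Lc : ℝ) ^ 4) (-((Lc : ℝ) ^ 8 / 2)) cΛ j κ' u')
            (diagK fun p c => γ j * ctGen 3 α Lc κ u p c) (diagK fun p c => γ j * ctGen 3 α Lc κ' u' p c)
            (diagK fun p c => γ j ^ 2 * (ctGen 3 α Lc κ u p c * ctGen 3 α Lc κ' u' p c)) +
          RB j α κ u κ' u')) x z (Sum.inl β) (Sum.inr m))
    (hBmf : ∀ (j : ℕ) (α : Fin 4) κ u κ' u' (x z : Fin 4 → ℤ) (m β : Fin 4),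
      ((cB * wB2 3 Lc j) • vh₂S κ (bref α κ u) κ' (bref α κ' u')) x z (Sum.inr m) (Sum.inl β) =
        ((reflSign α κ * reflSign α κ') • refK (Φ Lc α) ((cB * wB2 3 Lc j) • vh₂S κ u κ' u' +
          conjW (bhKStepAt 3 (toSite (ctrOff 4 Lc)) Lc j)
            (SpureRecAt 3 Lc (toSite (ctrOff 4 Lc)) ((Lc : ℝ) ^ 4) (-((Lc : ℝ) ^ 8 / 2)) cΛ j κ u)
            (SpureRecAt 3 Lc (toSite (ctrOff 4 Lc)) ((Lc : ℝ) ^ 4) (-((Lc : ℝ) ^ 8 / 2)) cΛ j κ' u')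
            (diagK fun p c => γ j * ctGen 3 α Lc κ u p c) (diagK fun p c => γ j * ctGen 3 α Lc κ' u' p c)
            (diagK fun p c => γ j ^ 2 * (ctGen 3 α Lc κ u p c * ctGen 3 α Lc κ' u' p c)) +
          RB j α κ u κ' u')) x z (Sum.inr m) (Sum.inl β))
    (hBmm : ∀ (j : ℕ) (α : Fin 4) κ u κ' u' (x z : Fin 4 → ℤ) (m m' : Fin 4),
      ((cB * wB2 3 Lc j) • vh₂S κ (bref α κ u) κ' (bref α κ' u')) x z (Sum.inr m) (Sum.inr m') =
        ((reflSign α κ * reflSign α κ') • refK (Φ Lc α) ((cB * wB2 3 Lc j) • vh₂S κ u κ' u' +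
          conjW (bhKStepAt 3 (toSite (ctrOff 4 Lc)) Lc j)
            (SpureRecAt 3 Lc (toSite (ctrOff 4 Lc)) ((Lc : ℝ) ^ 4) (-((Lc : ℝ) ^ 8 / 2)) cΛ j κ u)
            (SpureRecAt 3 Lc (toSite (ctrOff 4 Lc)) ((Lc : ℝ) ^ 4) (-((Lc : ℝ) ^ 8 / 2)) cΛ j κ' u')
            (diagK fun p c => γ j * ctGen 3 α Lc κ u p c) (diagK fun p c => γ j * ctGen 3 α Lc κ' u' p c)
            (diagK fun p c => γ j ^ 2 * (ctGen 3 α Lc κ u p c * ctGen 3 α Lc κ' u' p c)) +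
          RB j α κ u κ' u')) x z (Sum.inr m) (Sum.inr m'))
    -- THE DISPLAYED SPLIT SYMBOLS (canonical `h`), THE REMAINDER RECURSION, THE NEXT-LEVEL CLASSES
    (X2s : ℕ → Fin 4 → Fin 4 → (Fin 4 → ℤ) → Fin 4 → (Fin 4 → ℤ) → (Fin 4 → ℤ) → Fib 3 → ℝ)
    (Δ : ℕ → Fin 4 → Fin 4 → (Fin 4 → ℤ) → Fin 4 → (Fin 4 → ℤ) → MKer 4 (Fib 3))
    (hX2s : X2s = fun j α μ y ν y' p c =>
            (∑ κ, ∑' u, colH (coDressKBmAt (toSite (ctrOff 4 Lc)) Lc (KInvStep (d := 3) Lc j)) Lc μ y κ u *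
                ∑ κ', ∑' u', colH (coDressKBmAt (toSite (ctrOff 4 Lc)) Lc (KInvStep (d := 3) Lc j)) Lc ν y' κ' u' *
                  (γ j ^ 2 * (ctGen 3 α Lc κ u p c * ctGen 3 α Lc κ' u' p c))) +
              ∑ κ, ∑' u, colH (K2OfK (coDressKBmAt (toSite (ctrOff 4 Lc)) Lc (KInvStep (d := 3) Lc j)) Lc (SpureRecAt 3 Lc (toSite (ctrOff 4 Lc)) ((Lc : ℝ) ^ 4) (-((Lc : ℝ) ^ 8 / 2)) cΛ j)
                  (M1At 3 Lc (toSite (ctrOff 4 Lc)) cΛ j) ν y' +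
                (-(comp (comp (coDressKBmAt (toSite (ctrOff 4 Lc)) Lc (KInvStep (d := 3) Lc j))
              (conjV (bhKStepAt 3 (toSite (ctrOff 4 Lc)) Lc j)
                (diagK fun p c => ∑ κ, ∑' u, colH (coDressKBmAt (toSite (ctrOff 4 Lc)) Lc (KInvStep (d := 3) Lc j)) Lc ν y' κ u * (γ j * ctGen 3 α Lc κ u p c))))
              (coDressKBmAt (toSite (ctrOff 4 Lc)) Lc (KInvStep (d := 3) Lc j))))) Lc μ y κ u * (γ j * ctGen 3 α Lc κ u p c))
    (hΔ : Δ = fun j α μ y ν y' =>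
        (dM (-(comp (comp (coDressKBmAt (toSite (ctrOff 4 Lc)) Lc (KInvStep (d := 3) Lc j))
              (conjV (bhKStepAt 3 (toSite (ctrOff 4 Lc)) Lc j)
                (diagK fun p c => ∑ κ, ∑' u, colH (coDressKBmAt (toSite (ctrOff 4 Lc)) Lc (KInvStep (d := 3) Lc j)) Lc ν y' κ u * (γ j * ctGen 3 α Lc κ u p c))))
              (coDressKBmAt (toSite (ctrOff 4 Lc)) Lc (KInvStep (d := 3) Lc j))))
            Lc (SpureRecAt 3 Lc (toSite (ctrOff 4 Lc)) ((Lc : ℝ) ^ 4) (-((Lc : ℝ) ^ 8 / 2)) cΛ j) (M1At 3 Lc (toSite (ctrOff 4 Lc)) cΛ j) μ y +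
          (vertex2OfK (coDressKBmAt (toSite (ctrOff 4 Lc)) Lc (KInvStep (d := 3) Lc j)) Lc (R2 j α) μ y ν y' +
            (mixOfK (coDressKBmAt (toSite (ctrOff 4 Lc)) Lc (KInvStep (d := 3) Lc j)) Lc (RM j α) μ y ν y' + mixOfK (coDressKBmAt (toSite (ctrOff 4 Lc)) Lc (KInvStep (d := 3) Lc j)) Lc (RM j α) ν y' μ y))))
    (hR20 : ∀ (α κ : Fin 4) (u : Fin 4 → ℤ) (κ' : Fin 4) (u' : Fin 4 → ℤ), R2 0 α κ u κ' u' = cE₂ • RW α κ u κ' u' + RB 0 α κ u κ' u')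
    (hR2succ : ∀ (j : ℕ) (α κ : Fin 4) (u : Fin 4 → ℤ) (κ' : Fin 4) (u' : Fin 4 → ℤ),
      R2 (j + 1) α κ u κ' u' =
        -((cE₂ * wV4 3 Lc (j + 1)) • mmRead Lc
            (comp (comp (coDressKBmAt (toSite (ctrOff 4 Lc)) Lc (KInvStep (d := 3) Lc j))
              ((1 / 2 : ℝ) • conjV (bhKStepAt 3 (toSite (ctrOff 4 Lc)) Lc j) (diagK fun p a => X2s j α κ' u' κ u p a - X2s j α κ u κ' u' p a) +
                (1 / 2 : ℝ) • (Δ j α κ u κ' u' + Δ j α κ' u' κ u)))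
              (coDressKBmAt (toSite (ctrOff 4 Lc)) Lc (KInvStep (d := 3) Lc j)))) +
          RB (j + 1) α κ u κ' u' +
          conjV (mmRead Lc (coDressKBmAt (toSite (ctrOff 4 Lc)) Lc (KInvStep (d := 3) Lc j)))
            (diagK fun p c => cE₂ * wV4 3 Lc (j + 1) * mmSym Lc (X2s j α κ u κ' u') p c -
              wVH 3 Lc (j + 1) * (γ (j + 1) ^ 2 * (ctGen 3 α Lc κ u p c * ctGen 3 α Lc κ' u' p c))))
    (hR2c : ∀ (j : ℕ) (α : Fin 4), ∃ C δ : ℝ, 0 < δ ∧ LocStencil₂ (R2 (j + 1) α) C δ)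
    (hR2p : ∀ (j : ℕ) (α : Fin 4) κ u κ' u', trK (R2 (j + 1) α κ u κ' u') = -sgnK (R2 (j + 1) α κ u κ' u'))
    (hBt : ∀ (κ : Fin 4) (u : Fin 4 → ℤ) (κ' : Fin 4) (u' t : Fin 4 → ℤ),
      vh₂S κ (u + (Lc : ℤ) • t) κ' (u' + (Lc : ℤ) • t) = shiftK (-((Lc : ℤ) • t)) (vh₂S κ u κ' u'))
    (hmixt : ∀ (κ : Fin 4) (u : Fin 4 → ℤ) (μ : Fin 4) (w t : Fin 4 → ℤ),
      mixFF κ (u + (Lc : ℤ) • t) μ (w + t) = shiftK (-((Lc : ℤ) • t)) (mixFF κ u μ w))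
    :
    ∀ j : ℕ, AxisReflectionCovariant
      (flipK (TbalOf Lc (JsRecWAtOf (d := 3) hLc.pos (ctrOff_mem_box hLc.pos) ((Lc : ℝ) ^ 4) (-((Lc : ℝ) ^ 8 / 2)) cΛ cE₂ cB T hB hmix) j)) := by
  have hL1 : 1 ≤ Lc := hLc.pos
  have hcE₂ : cE₂ = (Lc : ℝ) ^ 8 := (lock2_iff cE₂ 0).1 (hlock2 0)
  -- the level-0 remainder as a family
  have hR20' : ∀ α : Fin 4, R2 0 α = fun κ u κ' u' => cE₂ • RW α κ u κ' u' + RB 0 α κ u κ' u' :=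
    fun α => funext fun κ => funext fun u => funext fun κ' => funext fun u' => hR20 α κ u κ' u'
  refine axisReflectionCovariant_flipK_TbalOf_JsRecWAtOf_of_letters_closed hLc cΛ cE₂ cB T hB hB0 hmix γ hγ hlock2
    (fun j α κ u κ' u' p c => γ j ^ 2 * (ctGen 3 α Lc κ u p c * ctGen 3 α Lc κ' u' p c)) R2 RM ?_ hM2 X2s Δ hX2s hΔ
    (fun j α => ⟨_, abs_ctGen_mul_ctGen_le α Lc (γ j ^ 2)⟩)
    (fun j α => ⟨_, 1, one_pos, locStencil₂_diagK_ctGen_mul_ctGen α Lc (γ j ^ 2) zero_le_one⟩)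
    ?_ ?_ hRMc hRMp RB hRBff (fun j => hBfm (j + 1)) (fun j => hBmf (j + 1)) (fun j => hBmm (j + 1)) hR2succ hBt hmixt
  · -- (h0) THE LEVEL-0 LETTER, ASSEMBLED from the Wilson law (hWff) and the border letter at level 0
    intro α κ u κ' u'
    have hwB : cB * wB2 3 Lc 0 = cB := by simp [BalabanStepW2.wB2]
    have hγ0 : γ 0 = (Lc : ℝ) ^ 4 * (-(1 / 2 : ℝ)) := by
      have hL : (Lc : ℝ) ≠ 0 := by exact_mod_cast NeZero.ne Lc
      rw [hγ 0, wVH_zero, stepScale_zero]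
      field_simp
    have ha : cE₂ = ((Lc : ℝ) ^ 4) ^ 2 := by rw [hcE₂]; ring
    have hQl : ∀ κ u κ' u' (x z : Fin 4 → ℤ) (m : Fin 4) (b' : Fib 3), wilsonW₂ 3 T κ u κ' u' x z (Sum.inr m) b' = 0 := by
      intro κ u κ' u' x z m b'; rcases b' with b | b <;> rfl
    have hQr : ∀ κ u κ' u' (x z : Fin 4 → ℤ) (a' : Fib 3) (m : Fin 4), wilsonW₂ 3 T κ u κ' u' x z a' (Sum.inr m) = 0 := by
      intro κ u κ' u' x z a' m; rcases a' with a | a <;> rfl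
    have hEl : ∀ κ u (x z : Fin 4 → ℤ) (m : Fin 4) (b' : Fib 3), wilsonA 3 κ u x z (Sum.inr m) b' = 0 := by
      intro κ u x z m b'; rcases b' with b | b <;> rfl
    have hEr : ∀ κ u (x z : Fin 4 → ℤ) (a' : Fib 3) (m : Fin 4), wilsonA 3 κ u x z a' (Sum.inr m) = 0 := by
      intro κ u x z a' m; rcases a' with a | a <;> rfl
    have hVff : ∀ κ u (x z : Fin 4 → ℤ) (β β' : Fin 4),
        ((-((Lc : ℝ) ^ 8 / 2)) • vhSAt (toSite (ctrOff 4 Lc)) 3 Lc rfl κ u) x z (Sum.inl β) (Sum.inl β') = 0 :=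
      fun κ u x z β β' => smul_vhSAt_inl_inl (Lc := Lc) _ _ κ u x z β β'
    have hBfm0 := hBfm 0 α
    have hBmf0 := hBmf 0 α
    have hBmm0 := hBmm 0 α
    simp only [hwB, SpureRecAt_zero_level, bhKStepAt_zero] at hBfm0 hBmf0 hBmm0
    have key := quarticZero_bref_of_ffLaw (d := 3) (L := Lc) (𝕄 := bhKStepAt 3 (toSite (ctrOff 4 Lc)) Lc 0) (a := cE₂) (aE := (Lc : ℝ) ^ 4)
      (b := cB) (κ₁ := -(1 / 2 : ℝ)) (γ' := γ 0) (α := α) (Q := wilsonW₂ 3 T) (R₀ := RW α) (B := vh₂S) (RB := RB 0 α) (E := wilsonA 3)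
      (Vbd := fun κ u => (-((Lc : ℝ) ^ 8 / 2)) • vhSAt (toSite (ctrOff 4 Lc)) 3 Lc rfl κ u)
      hγ0 ha hQl hQr hEl hEr (hRWl α) (hRWr α) hB0 (hRBff 0 α) hVff (hWff α) ?_ ?_ ?_ κ u κ' u'
    · simp only [T2RecAt_zero_level, SpureRecAt_zero_level, hR20]
      exact key
    · simpa only [bhKStepAt_zero] using hBfm0
    · simpa only [bhKStepAt_zero] using hBmf0
    · simpa only [bhKStepAt_zero] using hBmm0
  · -- the `LocStencil₂` class of `R2 j α`: level 0 from (hR20) and the classes of `RW`, `RB 0`; level j+1 given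
    intro j α
    cases j with
    | zero =>
      obtain ⟨C₁, δ₁, hδ₁, h1⟩ := hRWc α
      obtain ⟨C₂, δ₂, hδ₂, h2⟩ := hRBc 0 α
      refine ⟨|cE₂| * C₁ + C₂, min δ₁ δ₂, lt_min hδ₁ hδ₂, ?_⟩
      rw [hR20' α]
      exact locStencil₂_add' (locStencil₂_smul' cE₂ (h1.mono (min_le_left _ _))) (h2.mono (min_le_right _ _))
    | succ j => exact hR2c j α
  · -- the parity class of `R2 j α`
    intro j α κ u κ' u'
    cases j with
    | zero =>
      rw [hR20]
      exact parityOdd_add (parityOdd_smul cE₂ (hRWp α κ u κ' u')) (hRBp 0 α κ u κ' u')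
    | succ j => exact hR2p j α κ u κ' u'

end Wall

end Summit.QuantumFields.BalabanUV.Beta.SpineRooted

end
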